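import Literature.Analysis.FluidPDE.KNSSThm52Assembly
import Literature.Analysis.FluidPDE.SwirlMaximumPrinciple
import HarnessLib

/-!
# The swirl-free vorticity scalar `η = ω_θ/ϱ`: its lifted equation and maximum principle,
# local in space and time

Analysis/FluidPDE proof file (everything proved; no definitions, no named facts) on the way to
the named fact `Literature.Analysis.FluidPDE.Seregin2020_axisymmetricSingularPoint_typeII`
(G. Seregin, Anal. Math. Phys. 10 (2020), Paper 46 = arXiv:2006.04140, Thm. 2.1). The last step
of the printed proof (arXiv p. 8) reads: "any axially symmetric suitable weak solution with no
swirl, i.e., `u_φ = 0`, is smooth … (it can be done by considering a problem for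
`η = ω_φ / ϱ`, where `ω_φ = u_{3,ϱ} - u_{ϱ,3}`, and reduction of it to spatial dimension 5, see,
for example, [KangK2004])". The tree has this reduction for GLOBALLY smooth bounded families
(Koch–Nadirashvili–Seregin–Šverák 2009, Thm. 5.2: `KNSSThm52Assembly.liftAx_equation`, with
derivatives bounded and Lipschitz in time on `(-∞, 0)`). For a suitable weak solution, which is
smooth only near its regular points, the same computation is needed LOCALLY — on a time
interval `I` and at the points of a ball `B(c, R₁)` centred on the axis — together with its
classical consequence, the maximum principle for `η` on a parabolic cylinder. This file proves
both.

Setting (the hypotheses of the theorems below). `W : ℝ → ℝ³ → ℝ³` is, for `τ ∈ I` (`I` an open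
interval), a `C^∞` axisymmetric swirl-free field on all of `ℝ³` whose `x`-derivatives of every
order are continuous in `τ` uniformly in `x` (in applications `W = χ V` for a smooth
representative `V` of the solution near a regular region and an axisymmetric cut-off `χ`, so
nothing is assumed about the solution away from that region), and the (time-integrated,
classical) vorticity equation holds at the points of `B(c, R₁)`, with an integrand continuous in
time: `curl W(t) - curl W(s) = ∫ₛᵗ (Δ curl W - D(curl W)[W] + DW[curl W]) dτ` there. Then, with
`f(τ) = ω_θ/ϱ = hadamardQuotFst ((curl W τ) ·)₁` and its lift `F(τ) = liftAx (f τ)` to `ℝ⁵`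
(`AxisymmetricLiftR5`):

* `noSwirlLift_integral_eq`: for `y ∈ ℝ⁵` with `axisPt y ∈ B(c, R₁)` and `s ≤ t` in `I`,
  `F(t, y) - F(s, y) = ∫ₛᵗ (Δ₅ F - DF[ã])(τ, y) dτ`, `ã = u_ϱ P y/|P y| + u₃ e₄` (KNSS (5.10)
  lifted, `fₜ + u_ϱ f_ϱ + u₃ f₃ = Δf + (2/ϱ) f_ϱ`);
* `noSwirlLift_hasDerivAt`: the time lines of `F` are differentiable on `I` with
  `∂ₜF = Δ₅F - DF[ã]` (pointwise, classical);
* `noSwirl_abs_scalar_le_of_boundary`: for `c` on the axis and `R' ≤ R₁`, a bound `|f| ≤ M` on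
  the parabolic boundary of `[t₀, t₁] × B̄(c, R')` propagates to the whole cylinder (the weak
  parabolic maximum principle `SwirlMaximumPrinciple.weak_max_principle` on the lifted ball of
  `ℝ⁵`: at a critical point the drift term vanishes), whence the vorticity bound
  `‖curl W‖ ≤ M R'` there (`norm_curl_le_of_abs_scalar_le`), and the two local estimates feeding
  the boundary hypothesis (`abs_scalar_eq_norm_curl_div`: `|f| = |ω|/ϱ` off the axis;
  `abs_scalar_le_of_segment`: `|f x| ≤ sup ‖Dω₁‖` over the meridian segment of `x`).

The proof of the equation is the tree's (`KNSSThm52Assembly.liftAx_equation`): the weighted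
identity `ϱ² (…) = 0` at `x = axisPt y` from the `θ`-component of the vorticity equation
(`integral_scalarEq_of_vorticityEq`) and the pointwise lift formulas (`laplacian_liftAx`,
`fderiv_liftAx`, `liftDeriv_apply_drift`, `sq_mul_laplacian_liftAx`), continuity of both sides
in `y`, and removal of the weight across the lifted axis `{P y = 0}` by density — with the
time regularity furnished by uniform-in-`x` continuity in `τ` instead of Lipschitz bounds. The
maximum principle is the classical argument for swirl-free axisymmetric flows (Ladyzhenskaya
1968; Ukhovskii–Yudovich 1968: `η` is transported and diffused by a 5-dimensional heat operator
with drift), in local form.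

## References

* G. Seregin, Anal. Math. Phys. 10 (2020), Paper 46 = arXiv:2006.04140, proof of Thm. 2.1, last
  paragraph (p. 8). [Seregin2020]
* G. Koch, N. Nadirashvili, G. Seregin, V. Šverák, Acta Math. 203 (2009) 83–105 =
  arXiv:0709.3599, §5, (5.10) and p. 9 (the 5-dimensional lift). [KochNadirashviliSereginSverak2009]
* O. A. Ladyzhenskaya, Zap. Naučn. Sem. LOMI 7 (1968) 155–177; M. R. Ukhovskii, V. I. Yudovich,
  J. Appl. Math. Mech. 32 (1968) 52–61 (the equation and maximum principle for `ω_φ/ϱ`).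
  [Ladyzhenskaya1968]
* G. M. Lieberman, *Second order parabolic differential equations* (1996), Ch. II, Lemmas 2.1,
  2.3 (weak maximum principle). [Lieberman1996]
-/

noncomputable section

open Set Function Filter MeasureTheory Topology InnerProductSpace WithLp Metric
open scoped RealInnerProductSpace Laplacian ContDiff

namespace Literature.Analysis.FluidPDE

/-! ### Joint continuity from uniform-in-space continuity in time -/

section TimeContinuity

variable {X F : Type*} [TopologicalSpace X] [NormedAddCommGroup F]

/-- **Joint continuity from continuity in time uniform in space, and continuity in space.** If
`ψ(τ', x) → ψ(τ, x)` as `τ' → τ` within `S`, uniformly in `x`, and each `ψ(τ, ·)`, `τ ∈ S`, is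
continuous, then `ψ` is continuous on `S × X`. [folklore] -/
theorem continuousOn_prod_of_unifTime {ψ : ℝ → X → F} {S : Set ℝ}
    (hU : ∀ τ ∈ S, ∀ ε > 0, ∃ δ > 0, ∀ τ' ∈ S, |τ' - τ| < δ → ∀ x, ‖ψ τ' x - ψ τ x‖ ≤ ε)
    (hc : ∀ τ ∈ S, Continuous (ψ τ)) :
    ContinuousOn (fun p : ℝ × X => ψ p.1 p.2) (S ×ˢ univ) := by
  intro p hp
  obtain ⟨hp1, -⟩ := hp
  rw [ContinuousWithinAt, Metric.tendsto_nhds]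
  intro ε hε
  obtain ⟨δ, hδ, hδU⟩ := hU p.1 hp1 (ε / 2) (half_pos hε)
  have hx : ∀ᶠ q : ℝ × X in 𝓝[S ×ˢ univ] p, dist (ψ p.1 q.2) (ψ p.1 p.2) < ε / 2 := by
    have h1 : ContinuousAt (fun x => ψ p.1 x) p.2 := (hc p.1 hp1).continuousAt
    have h2 : ∀ᶠ x in 𝓝 p.2, dist (ψ p.1 x) (ψ p.1 p.2) < ε / 2 :=
      Metric.tendsto_nhds.1 h1 (ε / 2) (half_pos hε)
    exact nhdsWithin_le_nhds ((continuous_snd.tendsto p).eventually h2)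
  have ht : ∀ᶠ q : ℝ × X in 𝓝[S ×ˢ univ] p, q.1 ∈ S ∧ |q.1 - p.1| < δ := by
    have h1 : ∀ᶠ q : ℝ × X in 𝓝[S ×ˢ univ] p, q ∈ S ×ˢ (univ : Set X) := self_mem_nhdsWithin
    have h2 : ∀ᶠ q : ℝ × X in 𝓝 p, |q.1 - p.1| < δ := by
      have : ∀ᶠ s in 𝓝 p.1, |s - p.1| < δ := by
        have := Metric.ball_mem_nhds p.1 hδ
        filter_upwards [this] with s hs
        rwa [Metric.mem_ball, Real.dist_eq] at hs
      exact (continuous_fst.tendsto p).eventually this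
    filter_upwards [h1, nhdsWithin_le_nhds h2] with q hq1 hq2
    exact ⟨hq1.1, hq2⟩
  filter_upwards [hx, ht] with q hqx hqt
  calc dist (ψ q.1 q.2) (ψ p.1 p.2)
      ≤ dist (ψ q.1 q.2) (ψ p.1 q.2) + dist (ψ p.1 q.2) (ψ p.1 p.2) := dist_triangle _ _ _
    _ < ε / 2 + ε / 2 := by
        refine add_lt_add_of_le_of_lt ?_ hqx
        rw [dist_eq_norm]
        exact hδU q.1 hqt.1 hqt.2 q.2
    _ = ε := by ring

omit [TopologicalSpace X] in
/-- Continuity in time at a fixed point, from uniform-in-space continuity in time. [folklore] -/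
theorem continuousOn_time_of_unifTime {ψ : ℝ → X → F} {S : Set ℝ}
    (hU : ∀ τ ∈ S, ∀ ε > 0, ∃ δ > 0, ∀ τ' ∈ S, |τ' - τ| < δ → ∀ x, ‖ψ τ' x - ψ τ x‖ ≤ ε)
    (x : X) : ContinuousOn (fun τ => ψ τ x) S := by
  intro τ hτ
  rw [ContinuousWithinAt, Metric.tendsto_nhds]
  intro ε hε
  obtain ⟨δ, hδ, hδU⟩ := hU τ hτ (ε / 2) (half_pos hε)
  have h1 : ∀ᶠ τ' in 𝓝[S] τ, τ' ∈ S := self_mem_nhdsWithin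
  have h2 : ∀ᶠ τ' in 𝓝[S] τ, |τ' - τ| < δ := by
    have : ∀ᶠ s in 𝓝 τ, |s - τ| < δ := by
      filter_upwards [Metric.ball_mem_nhds τ hδ] with s hs
      rwa [Metric.mem_ball, Real.dist_eq] at hs
    exact nhdsWithin_le_nhds this
  filter_upwards [h1, h2] with τ' h1' h2'
  rw [dist_eq_norm]
  exact (hδU τ' h1' h2' x).trans_lt (half_lt_self hε)

end TimeContinuity

/-! ### The scalar `f = ω_θ / ϱ` of a time-dependent family: smoothness and joint continuity -/

section Family

variable {W : ℝ → EuclideanSpace ℝ (Fin 3) → EuclideanSpace ℝ (Fin 3)} {I : Set ℝ}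

/-- `ω₁ = (curl V)₁` is smooth for smooth `V` (`ω₁ = Λ₁ ∘ DV`). [folklore] -/
theorem contDiff_curl_apply_one {V : EuclideanSpace ℝ (Fin 3) → EuclideanSpace ℝ (Fin 3)}
    (hV : ContDiff ℝ ∞ V) : ContDiff ℝ ∞ fun y => curl V y 1 := by
  rw [curl_apply_one_eq_clm]
  exact (ContinuousLinearMap.contDiff _).comp (hV.fderiv_right (m := ∞) le_rfl)

/-- **`ω₁(τ) = (curl W(τ))₁` is smooth, and its derivatives inherit the uniform-in-`x` time
moduli of those of `W`** (one order higher: `ω₁ = Λ₁ ∘ DW` with a fixed linear `Λ₁`). [folklore] -/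
theorem curl_apply_one_unifTime (hsmooth : ∀ τ ∈ I, ContDiff ℝ ∞ (W τ))
    (hunif : ∀ k : ℕ, ∀ τ ∈ I, ∀ ε > 0, ∃ δ > 0, ∀ τ' ∈ I, |τ' - τ| < δ → ∀ y,
      ‖iteratedFDeriv ℝ k (W τ') y - iteratedFDeriv ℝ k (W τ) y‖ ≤ ε) :
    (∀ τ ∈ I, ContDiff ℝ ∞ fun y => curl (W τ) y 1) ∧
    (∀ n : ℕ, ∀ τ ∈ I, ∀ ε > 0, ∃ δ > 0, ∀ τ' ∈ I, |τ' - τ| < δ → ∀ y,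
      ‖iteratedFDeriv ℝ n (fun y => curl (W τ') y 1) y -
        iteratedFDeriv ℝ n (fun y => curl (W τ) y 1) y‖ ≤ ε) := by
  set Λ : (EuclideanSpace ℝ (Fin 3) →L[ℝ] EuclideanSpace ℝ (Fin 3)) →L[ℝ] ℝ :=
    (EuclideanSpace.proj (1 : Fin 3) : EuclideanSpace ℝ (Fin 3) →L[ℝ] ℝ).comp curlCLM with hΛ_def
  have heq : ∀ t, (fun y => curl (W t) y 1) = fun y => Λ (fderiv ℝ (W t) y) := fun t =>
    curl_apply_one_eq_clm (W t)
  have hsm : ∀ τ ∈ I, ContDiff ℝ ∞ fun y => curl (W τ) y 1 := fun τ hτ => by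
    rw [heq]; exact Λ.contDiff.comp ((hsmooth τ hτ).fderiv_right (m := ∞) le_rfl)
  refine ⟨hsm, fun n τ hτ ε hε => ?_⟩
  obtain ⟨δ, hδ, hδU⟩ := hunif (n + 1) τ hτ (ε / (‖Λ‖ + 1)) (by positivity)
  refine ⟨δ, hδ, fun τ' hτ' hlt y => ?_⟩
  have hct : ContDiff ℝ n (fun y => Λ (fderiv ℝ (W τ') y)) := by
    have := hsm τ' hτ'; rw [heq] at this; exact this.of_le (natCast_le_contDiff_infty n)
  have hcs : ContDiff ℝ n (fun y => Λ (fderiv ℝ (W τ) y)) := by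
    have := hsm τ hτ; rw [heq] at this; exact this.of_le (natCast_le_contDiff_infty n)
  have hdiff : (fun y => Λ (fderiv ℝ (W τ') y)) - (fun y => Λ (fderiv ℝ (W τ) y)) =
      fun y => Λ (fderiv ℝ (W τ' - W τ) y) := by
    funext y
    rw [Pi.sub_apply, fderiv_sub (((hsmooth τ' hτ').differentiable (by simp)) y)
      (((hsmooth τ hτ).differentiable (by simp)) y), map_sub]
  have hts : ContDiff ℝ ∞ (W τ' - W τ) := (hsmooth τ' hτ').sub (hsmooth τ hτ)
  rw [heq, heq, ← iteratedFDeriv_sub_apply hct.contDiffAt hcs.contDiffAt, hdiff]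
  have hΛ0 : 0 ≤ ‖Λ‖ := norm_nonneg Λ
  calc ‖iteratedFDeriv ℝ n (fun y => Λ (fderiv ℝ (W τ' - W τ) y)) y‖
      ≤ ‖Λ‖ * ‖iteratedFDeriv ℝ (n + 1) (W τ' - W τ) y‖ :=
        norm_iteratedFDeriv_clm_apply_fderiv_le Λ hts n y
    _ = ‖Λ‖ * ‖iteratedFDeriv ℝ (n + 1) (W τ') y - iteratedFDeriv ℝ (n + 1) (W τ) y‖ := by
        rw [iteratedFDeriv_sub_apply ((hsmooth τ' hτ').of_le (natCast_le_contDiff_infty _)).contDiffAt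
          ((hsmooth τ hτ).of_le (natCast_le_contDiff_infty _)).contDiffAt]
    _ ≤ ‖Λ‖ * (ε / (‖Λ‖ + 1)) := mul_le_mul_of_nonneg_left (hδU τ' hτ' hlt y) hΛ0
    _ ≤ ε := by
        rw [mul_div_assoc']
        rw [div_le_iff₀ (by positivity)]
        nlinarith

/-- **The scalar `f(τ) = hadamardQuotFst (curl W(τ))₁ = ω_θ/ϱ` of the family**: smooth slices,
and joint continuity on `I × ℝ³` of the quantities entering the lifted equation — `f`, `Df`,
`∂ᵢ∂ᵢf`, `hadamardQuotFst ∂₀f` — obtained from the uniform-in-`x` time moduli (everything is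
linear in `ω₁`, `KNSSThm52Assembly.hadamardQuotFst_liftData_sub_bounds`) and smoothness in `x`.
[folklore] -/
theorem scalar_family_continuousOn (hsmooth : ∀ τ ∈ I, ContDiff ℝ ∞ (W τ))
    (hunif : ∀ k : ℕ, ∀ τ ∈ I, ∀ ε > 0, ∃ δ > 0, ∀ τ' ∈ I, |τ' - τ| < δ → ∀ y,
      ‖iteratedFDeriv ℝ k (W τ') y - iteratedFDeriv ℝ k (W τ) y‖ ≤ ε) :
    (∀ τ ∈ I, ContDiff ℝ ∞ (hadamardQuotFst fun y => curl (W τ) y 1)) ∧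
    ContinuousOn (fun p : ℝ × EuclideanSpace ℝ (Fin 3) =>
      hadamardQuotFst (fun y => curl (W p.1) y 1) p.2) (I ×ˢ univ) ∧
    ContinuousOn (fun p : ℝ × EuclideanSpace ℝ (Fin 3) =>
      fderiv ℝ (hadamardQuotFst fun y => curl (W p.1) y 1) p.2) (I ×ˢ univ) ∧
    (∀ i : Fin 3, ContinuousOn (fun p : ℝ × EuclideanSpace ℝ (Fin 3) =>
      fderiv ℝ (fun z => fderiv ℝ (hadamardQuotFst fun y => curl (W p.1) y 1) z
        (EuclideanSpace.single i 1)) p.2 (EuclideanSpace.single i 1)) (I ×ˢ univ)) ∧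
    ContinuousOn (fun p : ℝ × EuclideanSpace ℝ (Fin 3) =>
      hadamardQuotFst (fun z => fderiv ℝ (hadamardQuotFst fun y => curl (W p.1) y 1) z
        (EuclideanSpace.single 0 1)) p.2) (I ×ˢ univ) := by
  obtain ⟨hw, hwU⟩ := curl_apply_one_unifTime hsmooth hunif
  set w : ℝ → EuclideanSpace ℝ (Fin 3) → ℝ := fun τ y => curl (W τ) y 1 with hw_def
  have hf : ∀ τ ∈ I, ContDiff ℝ ∞ (hadamardQuotFst (w τ)) := fun τ hτ =>
    contDiff_hadamardQuotFst (n := ⊤) (hw τ hτ)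
  -- the joint modulus of the four quantities
  have hmod : ∀ τ ∈ I, ∀ ε > 0, ∃ δ > 0, ∀ τ' ∈ I, |τ' - τ| < δ → ∀ x,
      |hadamardQuotFst (w τ') x - hadamardQuotFst (w τ) x| ≤ ε ∧
      ‖fderiv ℝ (hadamardQuotFst (w τ')) x - fderiv ℝ (hadamardQuotFst (w τ)) x‖ ≤ ε ∧
      (∀ i : Fin 3, |fderiv ℝ (fun z => fderiv ℝ (hadamardQuotFst (w τ')) z (EuclideanSpace.single i 1)) x
          (EuclideanSpace.single i 1) -
        fderiv ℝ (fun z => fderiv ℝ (hadamardQuotFst (w τ)) z (EuclideanSpace.single i 1)) x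
          (EuclideanSpace.single i 1)| ≤ ε) ∧
      |hadamardQuotFst (fun z => fderiv ℝ (hadamardQuotFst (w τ')) z (EuclideanSpace.single 0 1)) x -
        hadamardQuotFst (fun z => fderiv ℝ (hadamardQuotFst (w τ)) z (EuclideanSpace.single 0 1)) x|
          ≤ ε := by
    intro τ hτ ε hε
    obtain ⟨δ₁, hδ₁, h₁⟩ := hwU 1 τ hτ ε hε
    obtain ⟨δ₂, hδ₂, h₂⟩ := hwU 2 τ hτ ε hε
    obtain ⟨δ₃, hδ₃, h₃⟩ := hwU 3 τ hτ ε hε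
    refine ⟨min δ₁ (min δ₂ δ₃), lt_min hδ₁ (lt_min hδ₂ hδ₃), fun τ' hτ' hlt x => ?_⟩
    have hl1 : |τ' - τ| < δ₁ := hlt.trans_le (min_le_left _ _)
    have hl2 : |τ' - τ| < δ₂ := hlt.trans_le ((min_le_right _ _).trans (min_le_left _ _))
    have hl3 : |τ' - τ| < δ₃ := hlt.trans_le ((min_le_right _ _).trans (min_le_right _ _))
    exact hadamardQuotFst_liftData_sub_bounds (hw τ' hτ') (hw τ hτ) (fun y => h₁ τ' hτ' hl1 y)
      (fun y => h₂ τ' hτ' hl2 y) (fun y => h₃ τ' hτ' hl3 y) x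
  have hsm_d : ∀ τ ∈ I, ∀ v, ContDiff ℝ ∞ fun z => fderiv ℝ (hadamardQuotFst (w τ)) z v :=
    fun τ hτ v => contDiff_infty_fderiv_apply (hf τ hτ) v
  refine ⟨hf, ?_, ?_, fun i => ?_, ?_⟩
  · refine continuousOn_prod_of_unifTime (ψ := fun τ x => hadamardQuotFst (w τ) x)
      (fun τ hτ ε hε => ?_) (fun τ hτ => (hf τ hτ).continuous)
    obtain ⟨δ, hδ, h⟩ := hmod τ hτ ε hε
    exact ⟨δ, hδ, fun τ' hτ' hlt x => by
      rw [Real.norm_eq_abs]; exact (h τ' hτ' hlt x).1⟩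
  · refine continuousOn_prod_of_unifTime (ψ := fun τ x => fderiv ℝ (hadamardQuotFst (w τ)) x)
      (fun τ hτ ε hε => ?_) (fun τ hτ => (hf τ hτ).continuous_fderiv (by simp))
    obtain ⟨δ, hδ, h⟩ := hmod τ hτ ε hε
    exact ⟨δ, hδ, fun τ' hτ' hlt x => (h τ' hτ' hlt x).2.1⟩
  · refine continuousOn_prod_of_unifTime
      (ψ := fun τ x => fderiv ℝ (fun z => fderiv ℝ (hadamardQuotFst (w τ)) z
        (EuclideanSpace.single i 1)) x (EuclideanSpace.single i 1))
      (fun τ hτ ε hε => ?_)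
      (fun τ hτ => (contDiff_infty_fderiv_apply (hsm_d τ hτ _) _).continuous)
    obtain ⟨δ, hδ, h⟩ := hmod τ hτ ε hε
    exact ⟨δ, hδ, fun τ' hτ' hlt x => by
      rw [Real.norm_eq_abs]; exact (h τ' hτ' hlt x).2.2.1 i⟩
  · refine continuousOn_prod_of_unifTime
      (ψ := fun τ x => hadamardQuotFst (fun z => fderiv ℝ (hadamardQuotFst (w τ)) z
        (EuclideanSpace.single 0 1)) x)
      (fun τ hτ ε hε => ?_)
      (fun τ hτ => (contDiff_hadamardQuotFst (n := ⊤) (hsm_d τ hτ _)).continuous)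
    obtain ⟨δ, hδ, h⟩ := hmod τ hτ ε hε
    exact ⟨δ, hδ, fun τ' hτ' hlt x => by
      rw [Real.norm_eq_abs]; exact (h τ' hτ' hlt x).2.2.2⟩

/-- **Joint continuity of the family itself** from the order-zero modulus. [folklore] -/
theorem family_continuousOn (hsmooth : ∀ τ ∈ I, ContDiff ℝ ∞ (W τ))
    (hunif : ∀ k : ℕ, ∀ τ ∈ I, ∀ ε > 0, ∃ δ > 0, ∀ τ' ∈ I, |τ' - τ| < δ → ∀ y,
      ‖iteratedFDeriv ℝ k (W τ') y - iteratedFDeriv ℝ k (W τ) y‖ ≤ ε) :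
    ContinuousOn (fun p : ℝ × EuclideanSpace ℝ (Fin 3) => W p.1 p.2) (I ×ˢ univ) := by
  refine continuousOn_prod_of_unifTime (ψ := W) (fun τ hτ ε hε => ?_)
    (fun τ hτ => (hsmooth τ hτ).continuous)
  obtain ⟨δ, hδ, h⟩ := hunif 0 τ hτ ε hε
  refine ⟨δ, hδ, fun τ' hτ' hlt x => ?_⟩
  have e : ‖W τ' x - W τ x‖ = ‖iteratedFDeriv ℝ 0 (W τ') x - iteratedFDeriv ℝ 0 (W τ) x‖ := by
    rw [← iteratedFDeriv_sub_apply (((hsmooth τ' hτ').of_le (by norm_cast)).contDiffAt)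
      (((hsmooth τ hτ).of_le (by norm_cast)).contDiffAt), norm_iteratedFDeriv_zero, Pi.sub_apply]
  rw [e]
  exact h τ' hτ' hlt x

/-- Continuity in time, at a fixed point, of the family. [folklore] -/
theorem family_continuousOn_time (hsmooth : ∀ τ ∈ I, ContDiff ℝ ∞ (W τ))
    (hunif : ∀ k : ℕ, ∀ τ ∈ I, ∀ ε > 0, ∃ δ > 0, ∀ τ' ∈ I, |τ' - τ| < δ → ∀ y,
      ‖iteratedFDeriv ℝ k (W τ') y - iteratedFDeriv ℝ k (W τ) y‖ ≤ ε)
    (x : EuclideanSpace ℝ (Fin 3)) : ContinuousOn (fun τ => W τ x) I := by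
  have h := family_continuousOn hsmooth hunif
  have hm : MapsTo (fun τ : ℝ => (τ, x)) I (I ×ˢ (univ : Set (EuclideanSpace ℝ (Fin 3)))) :=
    fun τ hτ => ⟨hτ, mem_univ _⟩
  exact h.comp (Continuous.prodMk_left x).continuousOn hm

end Family

/-! ### Equality of continuous functions across the lifted axis `{P y = 0}` -/

section OffKer

/-- **A locally uniform version of `eq_of_eq_off_ker`**: two functions continuous on an open
`U ⊆ ℝ⁵` which agree at the points of `U` off the kernel of the horizontal projection agree on
`U` (the kernel, a proper subspace, has empty interior). [folklore] -/
theorem eqOn_of_eqOn_off_horizProj {X : Type*} [TopologicalSpace X] [T2Space X]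
    {U : Set (EuclideanSpace ℝ (Fin 5))} (hU : IsOpen U) {g₁ g₂ : EuclideanSpace ℝ (Fin 5) → X}
    (h₁ : ContinuousOn g₁ U) (h₂ : ContinuousOn g₂ U)
    (h : ∀ z ∈ U, horizProj z ≠ 0 → g₁ z = g₂ z) : EqOn g₁ g₂ U := by
  intro z hz
  by_cases hPz : horizProj z ≠ 0
  · exact h z hz hPz
  push Not at hPz
  -- approach `z` along `z + ε e₀`, which lies off the kernel for `ε ≠ 0`
  set v : EuclideanSpace ℝ (Fin 5) := EuclideanSpace.single 0 1 with hv
  have hPv : horizProj v ≠ 0 := by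
    rw [hv, horizProj_single_of_ne (by decide)]; simp
  set γ : ℝ → EuclideanSpace ℝ (Fin 5) := fun ε => z + ε • v with hγ
  have hγc : Continuous γ := by fun_prop
  have hγ0 : γ 0 = z := by simp [hγ]
  have hγU : ∀ᶠ ε in 𝓝 (0 : ℝ), γ ε ∈ U := by
    have : Tendsto γ (𝓝 0) (𝓝 z) := by rw [← hγ0]; exact hγc.tendsto 0
    exact this (hU.mem_nhds hz)
  have hγoff : ∀ᶠ ε in 𝓝[≠] (0 : ℝ), horizProj (γ ε) ≠ 0 := by
    refine eventually_nhdsWithin_of_forall fun ε hε => ?_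
    rw [hγ]
    simp only [map_add, map_smul, hPz, zero_add]
    exact smul_ne_zero hε hPv
  have heq : ∀ᶠ ε in 𝓝[≠] (0 : ℝ), g₁ (γ ε) = g₂ (γ ε) := by
    filter_upwards [hγoff, nhdsWithin_le_nhds hγU] with ε hoff hmem
    exact h _ hmem hoff
  -- limits along `γ` within `U`
  have hT : Tendsto γ (𝓝[≠] 0) (𝓝[U] z) := by
    refine tendsto_nhdsWithin_iff.2 ⟨?_, nhdsWithin_le_nhds hγU⟩
    rw [← hγ0]
    exact (hγc.tendsto 0).mono_left nhdsWithin_le_nhds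
  have hl₁ : Tendsto (fun ε => g₁ (γ ε)) (𝓝[≠] 0) (𝓝 (g₁ z)) := (h₁ z hz).tendsto.comp hT
  have hl₂ : Tendsto (fun ε => g₂ (γ ε)) (𝓝[≠] 0) (𝓝 (g₂ z)) := (h₂ z hz).tendsto.comp hT
  haveI : (𝓝[≠] (0 : ℝ)).NeBot := inferInstance
  exact tendsto_nhds_unique (hl₁.congr' heq) hl₂

end OffKer

/-! ### The lifted equation, local form -/

section Equation

variable {W : ℝ → EuclideanSpace ℝ (Fin 3) → EuclideanSpace ℝ (Fin 3)} {I : Set ℝ}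
  {c : EuclideanSpace ℝ (Fin 3)} {R₁ : ℝ}

/-- **Pointwise structure of the swirl-free vorticity family.** For `τ ∈ I`: the slice `W τ`
being smooth, axisymmetric and swirl free, `(curl W τ)₂ = 0`, `x₀(curl W τ)₀ + x₁(curl W τ)₁ = 0`,
`curl (W τ) = f τ · J` with `f τ = hadamardQuotFst ((curl W τ) ·)₁` smooth and axisymmetric
(`AxisymNoSwirlVorticity`). [folklore] -/
theorem noSwirl_family_structure (hsmooth : ∀ τ ∈ I, ContDiff ℝ ∞ (W τ))
    (hax : ∀ τ ∈ I, IsAxisymmetric (W τ)) (hsw : ∀ τ ∈ I, HasNoSwirl (W τ)) :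
    ∀ τ ∈ I, (∀ x : EuclideanSpace ℝ (Fin 3), curl (W τ) x 2 = 0) ∧
      (∀ x : EuclideanSpace ℝ (Fin 3), x 0 * curl (W τ) x 0 + x 1 * curl (W τ) x 1 = 0) ∧
      IsAxisymmetric (curl (W τ)) ∧
      IsAxisymmetricScalar (hadamardQuotFst fun y => curl (W τ) y 1) ∧
      (∀ x, curl (W τ) x = hadamardQuotFst (fun y => curl (W τ) y 1) x • rotGen x) := by
  intro τ hτ
  have h1 : ContDiff ℝ 1 (W τ) := (hsmooth τ hτ).of_le (by norm_cast)
  have h2 : ContDiff ℝ 2 (W τ) := (hsmooth τ hτ).of_le (by norm_cast)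
  have hd : Differentiable ℝ (W τ) := h1.differentiable one_ne_zero
  have hA : ∀ x : EuclideanSpace ℝ (Fin 3), curl (W τ) x 2 = 0 := curl_apply_two_eq_zero (hax τ hτ) (hsw τ hτ) h1
  have hB : ∀ x : EuclideanSpace ℝ (Fin 3), x 0 * curl (W τ) x 0 + x 1 * curl (W τ) x 1 = 0 := fun x =>
    inner_curl_horizontal_eq_zero (hax τ hτ) (hsw τ hτ) (hd x)
  refine ⟨hA, hB, (hax τ hτ).curl hd, isAxisymmetricScalar_hadamardQuotFst_curl (hax τ hτ) (hsw τ hτ) h2,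
    fun x => ?_⟩
  exact eq_hadamardQuotFst_smul_rotGen (contDiff_curl (n := 1) (by exact_mod_cast h2)) hA hB x

/-- **The pointwise form of `Δ₅F - DF[ã]`** for the lift `F = liftAx f` of the smooth
axisymmetric scalar `f = f τ`: at every `y' ∈ ℝ⁵` (axis included)
`Δ₅F(y') - DF(y')[u_ϱ P y'/|P y'| + u₃ e₄] = ∂₀∂₀f + ∂₂∂₂f + 3 hadamardQuotFst(∂₀f) - Df[u]` at
`x = axisPt y'` (`laplacian_liftAx`, `fderiv_liftAx`, `liftDeriv_apply_drift`). [folklore] -/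
theorem noSwirlLift_pointwise_form (hsmooth : ∀ τ ∈ I, ContDiff ℝ ∞ (W τ))
    (hax : ∀ τ ∈ I, IsAxisymmetric (W τ)) (hsw : ∀ τ ∈ I, HasNoSwirl (W τ))
    {τ : ℝ} (hτ : τ ∈ I) (y' : EuclideanSpace ℝ (Fin 5)) (u : EuclideanSpace ℝ (Fin 3)) :
    (Δ (liftAx (hadamardQuotFst fun z => curl (W τ) z 1))) y' -
        fderiv ℝ (liftAx (hadamardQuotFst fun z => curl (W τ) z 1)) y'
          (u 0 • (‖horizProj y'‖⁻¹ • horizProj y') + u 2 • EuclideanSpace.single 4 (1 : ℝ)) =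
      fderiv ℝ (fun z => fderiv ℝ (hadamardQuotFst fun z => curl (W τ) z 1) z (EuclideanSpace.single 0 1))
          (axisPt y') (EuclideanSpace.single 0 1) +
        fderiv ℝ (fun z => fderiv ℝ (hadamardQuotFst fun z => curl (W τ) z 1) z (EuclideanSpace.single 2 1))
          (axisPt y') (EuclideanSpace.single 2 1) +
        3 * hadamardQuotFst (fun z => fderiv ℝ (hadamardQuotFst fun z => curl (W τ) z 1) z
          (EuclideanSpace.single 0 1)) (axisPt y') -
        fderiv ℝ (hadamardQuotFst fun z => curl (W τ) z 1) (axisPt y') u := by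
  set f : EuclideanSpace ℝ (Fin 3) → ℝ := hadamardQuotFst fun z => curl (W τ) z 1 with hf_def
  have hf : ContDiff ℝ ∞ f := contDiff_hadamardQuotFst (n := ⊤) (contDiff_curl_apply_one (hsmooth τ hτ))
  obtain ⟨-, -, -, hfax, -⟩ := noSwirl_family_structure hsmooth hax hsw τ hτ
  have hev : IsEvenC 0 f := hfax.isEvenC_zero
  have hf4 : ContDiff ℝ 4 f := hf.of_le (by norm_cast)
  have hf2 : ContDiff ℝ 2 f := hf.of_le (by norm_cast)
  have hfd : Differentiable ℝ f := hf.differentiable (by simp)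
  have h0 : ∀ x : EuclideanSpace ℝ (Fin 3), x 0 = 0 → fderiv ℝ f x (EuclideanSpace.single 0 1) = 0 :=
    fun x hx => hev.fderiv_single_zero_eq_zero hfd hx
  have h1 : ∀ x : EuclideanSpace ℝ (Fin 3), x 1 = 0 → fderiv ℝ f x (EuclideanSpace.single 1 1) = 0 :=
    fun x hx => hfax.isEvenC_one.fderiv_single_one_eq_zero hfd hx
  rw [laplacian_liftAx hf4 hev y', fderiv_liftAx hf2 h0 y', liftDeriv_apply_drift hf2 h0 h1 y' u]

/-- **Regularity of the scalar family under an abstract name.** With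
`f τ = hadamardQuotFst ((curl W τ) ·)₁`: smooth axisymmetric slices, even in `x₀`, with
`∂₀ f = 0` on `{x₀ = 0}` and `∂₁ f = 0` on `{x₁ = 0}`, for `τ ∈ I`. [folklore] -/
theorem noSwirl_scalar_slices (hsmooth : ∀ τ ∈ I, ContDiff ℝ ∞ (W τ))
    (hax : ∀ τ ∈ I, IsAxisymmetric (W τ)) (hsw : ∀ τ ∈ I, HasNoSwirl (W τ))
    {f : ℝ → EuclideanSpace ℝ (Fin 3) → ℝ} (hfW : ∀ τ, f τ = hadamardQuotFst fun z => curl (W τ) z 1) :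
    ∀ τ ∈ I, ContDiff ℝ ∞ (f τ) ∧ IsAxisymmetricScalar (f τ) ∧ IsEvenC 0 (f τ) ∧
      (∀ x : EuclideanSpace ℝ (Fin 3), x 0 = 0 → fderiv ℝ (f τ) x (EuclideanSpace.single 0 1) = 0) ∧
      (∀ x : EuclideanSpace ℝ (Fin 3), x 1 = 0 → fderiv ℝ (f τ) x (EuclideanSpace.single 1 1) = 0) := by
  intro τ hτ
  have hf : ContDiff ℝ ∞ (f τ) := by
    rw [hfW]; exact contDiff_hadamardQuotFst (n := ⊤) (contDiff_curl_apply_one (hsmooth τ hτ))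
  have hfax : IsAxisymmetricScalar (f τ) := by
    rw [hfW]; exact (noSwirl_family_structure hsmooth hax hsw τ hτ).2.2.2.1
  have hfd : Differentiable ℝ (f τ) := hf.differentiable (by simp)
  exact ⟨hf, hfax, hfax.isEvenC_zero, fun x hx => hfax.isEvenC_zero.fderiv_single_zero_eq_zero hfd hx,
    fun x hx => hfax.isEvenC_one.fderiv_single_one_eq_zero hfd hx⟩

/-- **The lift `F(τ) = liftAx (f τ)` has `C²` slices and is jointly continuous on `I × ℝ⁵`**
(`contDiff_two_liftAx`; the values `F(τ, y) = f(τ, axisPt y)` with `f` jointly continuous).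
[folklore] -/
theorem noSwirlLift_slices (hsmooth : ∀ τ ∈ I, ContDiff ℝ ∞ (W τ))
    (hunif : ∀ k : ℕ, ∀ τ ∈ I, ∀ ε > 0, ∃ δ > 0, ∀ τ' ∈ I, |τ' - τ| < δ → ∀ y,
      ‖iteratedFDeriv ℝ k (W τ') y - iteratedFDeriv ℝ k (W τ) y‖ ≤ ε)
    (hax : ∀ τ ∈ I, IsAxisymmetric (W τ)) (hsw : ∀ τ ∈ I, HasNoSwirl (W τ))
    {f : ℝ → EuclideanSpace ℝ (Fin 3) → ℝ} (hfW : ∀ τ, f τ = hadamardQuotFst fun z => curl (W τ) z 1) :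
    (∀ τ ∈ I, ContDiff ℝ 2 (liftAx (f τ))) ∧
    ContinuousOn (fun p : ℝ × EuclideanSpace ℝ (Fin 5) => liftAx (f p.1) p.2) (I ×ˢ univ) := by
  have hsl := noSwirl_scalar_slices hsmooth hax hsw hfW
  refine ⟨fun τ hτ => contDiff_two_liftAx ((hsl τ hτ).1.of_le (by norm_cast)) (hsl τ hτ).2.2.1, ?_⟩
  obtain ⟨-, hQc', -, -, -⟩ := scalar_family_continuousOn hsmooth hunif
  have hfun : (fun τ => hadamardQuotFst fun z => curl (W τ) z 1) = f := funext fun τ => (hfW τ).symm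
  have hQc : ContinuousOn (fun p : ℝ × EuclideanSpace ℝ (Fin 3) => f p.1 p.2) (I ×ˢ univ) := by
    simpa only [← hfun] using hQc'
  have hA : Continuous fun p : ℝ × EuclideanSpace ℝ (Fin 5) => (p.1, axisPt p.2) :=
    continuous_fst.prodMk (continuous_axisPt.comp continuous_snd)
  have hmaps : MapsTo (fun p : ℝ × EuclideanSpace ℝ (Fin 5) => (p.1, axisPt p.2)) (I ×ˢ univ)
      (I ×ˢ (univ : Set (EuclideanSpace ℝ (Fin 3)))) := fun p hp => ⟨hp.1, mem_univ _⟩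
  exact hQc.comp hA.continuousOn hmaps

/-- **Joint continuity of the integrand `Δ₅F - DF[ã]` of the lifted equation on `I × ℝ⁵`**
(through its pointwise form `noSwirlLift_pointwise_form` and the joint continuity of the lift
data, `scalar_family_continuousOn`). [folklore] -/
theorem noSwirlLift_integrand_continuousOn (hsmooth : ∀ τ ∈ I, ContDiff ℝ ∞ (W τ))
    (hunif : ∀ k : ℕ, ∀ τ ∈ I, ∀ ε > 0, ∃ δ > 0, ∀ τ' ∈ I, |τ' - τ| < δ → ∀ y,
      ‖iteratedFDeriv ℝ k (W τ') y - iteratedFDeriv ℝ k (W τ) y‖ ≤ ε)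
    (hax : ∀ τ ∈ I, IsAxisymmetric (W τ)) (hsw : ∀ τ ∈ I, HasNoSwirl (W τ))
    {f : ℝ → EuclideanSpace ℝ (Fin 3) → ℝ} (hfW : ∀ τ, f τ = hadamardQuotFst fun z => curl (W τ) z 1) :
    ContinuousOn (fun p : ℝ × EuclideanSpace ℝ (Fin 5) =>
      (Δ (liftAx (f p.1))) p.2 - fderiv ℝ (liftAx (f p.1)) p.2
        ((W p.1 (axisPt p.2)) 0 • (‖horizProj p.2‖⁻¹ • horizProj p.2) +
          (W p.1 (axisPt p.2)) 2 • EuclideanSpace.single 4 (1 : ℝ))) (I ×ˢ univ) := by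
  obtain ⟨-, -, hDc', hiic', hqc'⟩ := scalar_family_continuousOn hsmooth hunif
  have hfun : (fun τ => hadamardQuotFst fun z => curl (W τ) z 1) = f := funext fun τ => (hfW τ).symm
  have hDc : ContinuousOn (fun p : ℝ × EuclideanSpace ℝ (Fin 3) => fderiv ℝ (f p.1) p.2) (I ×ˢ univ) := by
    simpa only [← hfun] using hDc'
  have hiic : ∀ i : Fin 3, ContinuousOn (fun p : ℝ × EuclideanSpace ℝ (Fin 3) =>
      fderiv ℝ (fun z => fderiv ℝ (f p.1) z (EuclideanSpace.single i 1)) p.2 (EuclideanSpace.single i 1))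
      (I ×ˢ univ) := fun i => by
    simpa only [← hfun] using hiic' i
  have hqc : ContinuousOn (fun p : ℝ × EuclideanSpace ℝ (Fin 3) =>
      hadamardQuotFst (fun z => fderiv ℝ (f p.1) z (EuclideanSpace.single 0 1)) p.2) (I ×ˢ univ) := by
    simpa only [← hfun] using hqc'
  have hWc := family_continuousOn hsmooth hunif
  have hA : Continuous fun p : ℝ × EuclideanSpace ℝ (Fin 5) => (p.1, axisPt p.2) :=
    continuous_fst.prodMk (continuous_axisPt.comp continuous_snd)
  have hmaps : MapsTo (fun p : ℝ × EuclideanSpace ℝ (Fin 5) => (p.1, axisPt p.2)) (I ×ˢ univ)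
      (I ×ˢ (univ : Set (EuclideanSpace ℝ (Fin 3)))) := fun p hp => ⟨hp.1, mem_univ _⟩
  have hW' : ContinuousOn (fun p : ℝ × EuclideanSpace ℝ (Fin 5) => W p.1 (axisPt p.2)) (I ×ˢ univ) :=
    hWc.comp hA.continuousOn hmaps
  have hD' : ContinuousOn (fun p : ℝ × EuclideanSpace ℝ (Fin 5) =>
      fderiv ℝ (f p.1) (axisPt p.2) (W p.1 (axisPt p.2))) (I ×ˢ univ) :=
    (hDc.comp hA.continuousOn hmaps).clm_apply hW'
  have h : ContinuousOn (fun p : ℝ × EuclideanSpace ℝ (Fin 5) =>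
      fderiv ℝ (fun z => fderiv ℝ (f p.1) z (EuclideanSpace.single 0 1)) (axisPt p.2)
          (EuclideanSpace.single 0 1) +
        fderiv ℝ (fun z => fderiv ℝ (f p.1) z (EuclideanSpace.single 2 1)) (axisPt p.2)
          (EuclideanSpace.single 2 1) +
        3 * hadamardQuotFst (fun z => fderiv ℝ (f p.1) z (EuclideanSpace.single 0 1)) (axisPt p.2) -
        fderiv ℝ (f p.1) (axisPt p.2) (W p.1 (axisPt p.2))) (I ×ˢ univ) :=
    ((((hiic 0).comp hA.continuousOn hmaps).add ((hiic 2).comp hA.continuousOn hmaps)).add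
      (continuousOn_const.mul (hqc.comp hA.continuousOn hmaps))).sub hD'
  refine h.congr fun p hp => ?_
  dsimp only
  rw [hfW]
  exact noSwirlLift_pointwise_form hsmooth hax hsw hp.1 p.2 (W p.1 (axisPt p.2))

/-- Continuity in time, at a fixed `y ∈ ℝ⁵`, of the integrand of the lifted equation. [folklore] -/
theorem noSwirlLift_integrand_continuousOn_time (hsmooth : ∀ τ ∈ I, ContDiff ℝ ∞ (W τ))
    (hunif : ∀ k : ℕ, ∀ τ ∈ I, ∀ ε > 0, ∃ δ > 0, ∀ τ' ∈ I, |τ' - τ| < δ → ∀ y,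
      ‖iteratedFDeriv ℝ k (W τ') y - iteratedFDeriv ℝ k (W τ) y‖ ≤ ε)
    (hax : ∀ τ ∈ I, IsAxisymmetric (W τ)) (hsw : ∀ τ ∈ I, HasNoSwirl (W τ))
    {f : ℝ → EuclideanSpace ℝ (Fin 3) → ℝ} (hfW : ∀ τ, f τ = hadamardQuotFst fun z => curl (W τ) z 1)
    (y : EuclideanSpace ℝ (Fin 5)) :
    ContinuousOn (fun τ => (Δ (liftAx (f τ))) y - fderiv ℝ (liftAx (f τ)) y
        ((W τ (axisPt y)) 0 • (‖horizProj y‖⁻¹ • horizProj y) +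
          (W τ (axisPt y)) 2 • EuclideanSpace.single 4 (1 : ℝ))) I := by
  have h := noSwirlLift_integrand_continuousOn hsmooth hunif hax hsw hfW
  have hm : MapsTo (fun τ : ℝ => (τ, y)) I (I ×ˢ (univ : Set (EuclideanSpace ℝ (Fin 5)))) :=
    fun τ hτ => ⟨hτ, mem_univ _⟩
  have h2 := h.comp (Continuous.prodMk_left y).continuousOn hm
  exact h2

/-- **The lifted swirl-free vorticity equation, local integrated form** (KNSS 2009 (5.10) lifted
to `ℝ⁵`, p. 9; the computation behind Seregin 2020's "reduction of it to spatial dimension 5",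
arXiv p. 8), stated for an abstract name `f` of the scalar family
`f τ = hadamardQuotFst ((curl W τ) ·)₁ = ω_θ/ϱ` (see `noSwirlLift_integral_eq`). Under the
standing hypotheses of this file (module docstring) — smooth axisymmetric swirl-free slices
`W τ`, `τ ∈ I` (`I` an interval), with uniform-in-`x` time moduli of all `x`-derivatives, and the
classical time-integrated vorticity equation at the points of the ball `B(c, R₁)` with an
integrand continuous in time — the lift `F(τ) = liftAx (f τ)` satisfies, for every `y ∈ ℝ⁵` with
`axisPt y ∈ B(c, R₁)` and `s ≤ t` in `I`,
`F(t, y) - F(s, y) = ∫ₛᵗ (Δ₅F(τ, y) - DF(τ, y)[u_ϱ P y/|P y| + u₃ e₄]) dτ`, `u = W τ (axisPt y)`.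
[cite: KochNadirashviliSereginSverak2009, §5 (5.10) and p. 9; Seregin2020, proof of Thm. 2.1, last paragraph (arXiv p. 8)] -/
theorem noSwirlLift_integral_eq' (hIc : I.OrdConnected)
    (hsmooth : ∀ τ ∈ I, ContDiff ℝ ∞ (W τ))
    (hunif : ∀ k : ℕ, ∀ τ ∈ I, ∀ ε > 0, ∃ δ > 0, ∀ τ' ∈ I, |τ' - τ| < δ → ∀ y,
      ‖iteratedFDeriv ℝ k (W τ') y - iteratedFDeriv ℝ k (W τ) y‖ ≤ ε)
    (hax : ∀ τ ∈ I, IsAxisymmetric (W τ)) (hsw : ∀ τ ∈ I, HasNoSwirl (W τ))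
    (hvort : ∀ x ∈ ball c R₁, ∀ s ∈ I, ∀ t ∈ I, s ≤ t →
      curl (W t) x - curl (W s) x =
        ∫ τ in s..t, ((Δ (curl (W τ))) x - fderiv ℝ (curl (W τ)) x (W τ x) +
          fderiv ℝ (W τ) x (curl (W τ) x)))
    (hvortc : ∀ x ∈ ball c R₁, ContinuousOn (fun τ => (Δ (curl (W τ))) x -
      fderiv ℝ (curl (W τ)) x (W τ x) + fderiv ℝ (W τ) x (curl (W τ) x)) I)
    {f : ℝ → EuclideanSpace ℝ (Fin 3) → ℝ} (hfW : ∀ τ, f τ = hadamardQuotFst fun z => curl (W τ) z 1)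
    {y : EuclideanSpace ℝ (Fin 5)} (hy : axisPt y ∈ ball c R₁) {s t : ℝ} (hs : s ∈ I) (ht : t ∈ I)
    (hst : s ≤ t) :
    liftAx (f t) y - liftAx (f s) y =
      ∫ τ in s..t, ((Δ (liftAx (f τ))) y - fderiv ℝ (liftAx (f τ)) y
        ((W τ (axisPt y)) 0 • (‖horizProj y‖⁻¹ • horizProj y) +
          (W τ (axisPt y)) 2 • EuclideanSpace.single 4 (1 : ℝ))) := by
  -- ## regularity of the scalar family
  have hstI : Icc s t ⊆ I := hIc.out hs ht
  have hsl := noSwirl_scalar_slices hsmooth hax hsw hfW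
  have hf : ∀ τ ∈ I, ContDiff ℝ ∞ (f τ) := fun τ hτ => (hsl τ hτ).1
  have hfax : ∀ τ ∈ I, IsAxisymmetricScalar (f τ) := fun τ hτ => (hsl τ hτ).2.1
  have hf4 : ∀ τ ∈ I, ContDiff ℝ 4 (f τ) := fun τ hτ => (hf τ hτ).of_le (by norm_cast)
  have hf2 : ∀ τ ∈ I, ContDiff ℝ 2 (f τ) := fun τ hτ => (hf τ hτ).of_le (by norm_cast)
  have h0 : ∀ τ ∈ I, ∀ x : EuclideanSpace ℝ (Fin 3), x 0 = 0 →
      fderiv ℝ (f τ) x (EuclideanSpace.single 0 1) = 0 := fun τ hτ => (hsl τ hτ).2.2.2.1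
  have h1 : ∀ τ ∈ I, ∀ x : EuclideanSpace ℝ (Fin 3), x 1 = 0 →
      fderiv ℝ (f τ) x (EuclideanSpace.single 1 1) = 0 := fun τ hτ => (hsl τ hτ).2.2.2.2
  have hstr := noSwirl_family_structure hsmooth hax hsw
  -- ## Step 1: the weighted identity at every `y'` above the ball
  have hweighted : ∀ y' : EuclideanSpace ℝ (Fin 5), axisPt y' ∈ ball c R₁ →
      ‖horizProj y'‖ ^ 2 * ((liftAx (f t) y' - liftAx (f s) y') -
        ∫ τ in s..t, ((Δ (liftAx (f τ))) y' - fderiv ℝ (liftAx (f τ)) y'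
          ((W τ (axisPt y')) 0 • (‖horizProj y'‖⁻¹ • horizProj y') +
            (W τ (axisPt y')) 2 • EuclideanSpace.single 4 (1 : ℝ)))) = 0 := by
    intro y' hy'
    -- the data of `integral_scalarEq_of_vorticityEq` at `x' = axisPt y'`
    have hU4 : ∀ τ ∈ Icc s t, ContDiff ℝ 4 (W τ) := fun τ hτ =>
      (hsmooth τ (hstI hτ)).of_le (by norm_cast)
    have h2' : ∀ τ ∈ Icc s t, ∀ z : EuclideanSpace ℝ (Fin 3), curl (W τ) z 2 = 0 := fun τ hτ =>
      (hstr τ (hstI hτ)).1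
    have hb' : ∀ τ ∈ Icc s t, ∀ z : EuclideanSpace ℝ (Fin 3),
        z 0 * curl (W τ) z 0 + z 1 * curl (W τ) z 1 = 0 := fun τ hτ => (hstr τ (hstI hτ)).2.1
    have hax' : ∀ᵐ τ ∂(volume : Measure ℝ), τ ∈ Ioo s t →
        fderiv ℝ (W τ) (axisPt y') (rotGen (axisPt y')) =
          rotGen (W τ (axisPt y') + (0 : ℝ → EuclideanSpace ℝ (Fin 3)) τ) := by
      refine ae_of_all _ fun τ hτI => ?_
      have hτ : τ ∈ I := hstI (Ioo_subset_Icc_self hτI)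
      have hd : DifferentiableAt ℝ (W τ) (axisPt y') := ((hsmooth τ hτ).differentiable (by simp)) _
      rw [Pi.zero_apply, add_zero]
      exact (hax τ hτ).fderiv_rotGen hd
    have hint : IntervalIntegrable (fun τ => (Δ (curl (W τ))) (axisPt y') -
        fderiv ℝ (curl (W τ)) (axisPt y') (W τ (axisPt y') + (0 : ℝ → EuclideanSpace ℝ (Fin 3)) τ) +
          fderiv ℝ (W τ) (axisPt y') (curl (W τ) (axisPt y'))) volume s t := by
      have hc' : ContinuousOn (fun τ => (Δ (curl (W τ))) (axisPt y') -
          fderiv ℝ (curl (W τ)) (axisPt y') (W τ (axisPt y')) +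
            fderiv ℝ (W τ) (axisPt y') (curl (W τ) (axisPt y'))) (uIcc s t) := by
        rw [uIcc_of_le hst]; exact (hvortc _ hy').mono hstI
      simpa only [Pi.zero_apply, add_zero] using hc'.intervalIntegrable (μ := volume)
    have heq' : curl (W t) (axisPt y') - curl (W s) (axisPt y') =
        ∫ τ in s..t, ((Δ (curl (W τ))) (axisPt y') -
          fderiv ℝ (curl (W τ)) (axisPt y') (W τ (axisPt y') + (0 : ℝ → EuclideanSpace ℝ (Fin 3)) τ) +
            fderiv ℝ (W τ) (axisPt y') (curl (W τ) (axisPt y'))) := by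
      simpa only [Pi.zero_apply, add_zero] using hvort _ hy' s hs t ht hst
    have hB2 := integral_scalarEq_of_vorticityEq hst hU4 h2' hb' hax' hint heq'
    simp only [← hfW] at hB2
    -- rewrite the integrand through the lift
    have hI' : ∀ τ ∈ uIcc s t,
        (axisPt y' 0 ^ 2 + axisPt y' 1 ^ 2) * ((Δ (f τ)) (axisPt y') -
            fderiv ℝ (f τ) (axisPt y') (W τ (axisPt y') + (0 : ℝ → EuclideanSpace ℝ (Fin 3)) τ)) +
          2 * (axisPt y' 0 * fderiv ℝ (f τ) (axisPt y') (EuclideanSpace.single 0 1) +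
            axisPt y' 1 * fderiv ℝ (f τ) (axisPt y') (EuclideanSpace.single 1 1)) =
        (axisPt y' 0 ^ 2 + axisPt y' 1 ^ 2) * ((Δ (liftAx (f τ))) y' - fderiv ℝ (liftAx (f τ)) y'
          ((W τ (axisPt y')) 0 • (‖horizProj y'‖⁻¹ • horizProj y') +
            (W τ (axisPt y')) 2 • EuclideanSpace.single 4 (1 : ℝ))) := by
      intro τ hτ
      rw [uIcc_of_le hst] at hτ
      have hτ0 : τ ∈ I := hstI hτ
      have hS := sq_mul_laplacian_liftAx (hf4 τ hτ0) (hfax τ hτ0) y'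
      rw [fderiv_liftAx (hf2 τ hτ0) (h0 τ hτ0) y',
        liftDeriv_apply_drift (hf2 τ hτ0) (h0 τ hτ0) (h1 τ hτ0) y' (W τ (axisPt y')), Pi.zero_apply,
        add_zero]
      linear_combination (-1 : ℝ) * hS
    rw [intervalIntegral.integral_congr hI', intervalIntegral.integral_const_mul] at hB2
    have hr2 : axisPt y' 0 ^ 2 + axisPt y' 1 ^ 2 = ‖horizProj y'‖ ^ 2 := by
      rw [axisPt_apply_zero, axisPt_apply_one]; ring
    rw [← hr2]
    have hval : ∀ τ, liftAx (f τ) y' = f τ (axisPt y') := fun τ => rfl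
    rw [hval, hval]
    linear_combination hB2
  -- ## Step 2: continuity of both sides on the open set above the ball
  have hUo : IsOpen (axisPt ⁻¹' ball c R₁ : Set (EuclideanSpace ℝ (Fin 5))) :=
    isOpen_ball.preimage continuous_axisPt
  have hΦc := noSwirlLift_integrand_continuousOn hsmooth hunif hax hsw hfW
  -- the right-hand side as a parametric integral of a globally continuous integrand
  obtain ⟨g, hg⟩ : ∃ g : EuclideanSpace ℝ (Fin 5) → ℝ → ℝ, ∀ y' τ, g y' τ =
      (Δ (liftAx (f (projIcc s t hst τ)))) y' - fderiv ℝ (liftAx (f (projIcc s t hst τ))) y'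
        ((W (projIcc s t hst τ) (axisPt y')) 0 • (‖horizProj y'‖⁻¹ • horizProj y') +
          (W (projIcc s t hst τ) (axisPt y')) 2 • EuclideanSpace.single 4 (1 : ℝ)) :=
    ⟨_, fun _ _ => rfl⟩
  have hgc : Continuous (uncurry g) := by
    have hπ : Continuous fun q : EuclideanSpace ℝ (Fin 5) × ℝ => ((projIcc s t hst q.2 : ℝ), q.1) :=
      (continuous_subtype_val.comp (continuous_projIcc.comp continuous_snd)).prodMk continuous_fst
    have hπm : ∀ q : EuclideanSpace ℝ (Fin 5) × ℝ,
        ((projIcc s t hst q.2 : ℝ), q.1) ∈ I ×ˢ (univ : Set (EuclideanSpace ℝ (Fin 5))) := fun q =>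
      ⟨hstI (projIcc s t hst q.2).2, mem_univ _⟩
    have h := hΦc.comp_continuous hπ hπm
    refine h.congr fun q => ?_
    simp only [comp_apply, uncurry, hg]
  have hRc : Continuous fun y' : EuclideanSpace ℝ (Fin 5) => ∫ τ in s..t, g y' τ :=
    intervalIntegral.continuous_parametric_intervalIntegral_of_continuous' hgc s t
  have hR_eq : ∀ y' : EuclideanSpace ℝ (Fin 5),
      (∫ τ in s..t, ((Δ (liftAx (f τ))) y' - fderiv ℝ (liftAx (f τ)) y'
          ((W τ (axisPt y')) 0 • (‖horizProj y'‖⁻¹ • horizProj y') +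
            (W τ (axisPt y')) 2 • EuclideanSpace.single 4 (1 : ℝ)))) =
        ∫ τ in s..t, g y' τ := by
    intro y'
    refine intervalIntegral.integral_congr fun τ hτ => ?_
    rw [uIcc_of_le hst] at hτ
    rw [hg, projIcc_of_mem hst hτ]
  have hLc : Continuous fun y' : EuclideanSpace ℝ (Fin 5) => liftAx (f t) y' - liftAx (f s) y' :=
    (continuous_liftAx (hf t ht).continuous).sub (continuous_liftAx (hf s hs).continuous)
  -- ## conclusion across the lifted axis
  have key : EqOn (fun y' => liftAx (f t) y' - liftAx (f s) y')
      (fun y' => ∫ τ in s..t, ((Δ (liftAx (f τ))) y' - fderiv ℝ (liftAx (f τ)) y'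
          ((W τ (axisPt y')) 0 • (‖horizProj y'‖⁻¹ • horizProj y') +
            (W τ (axisPt y')) 2 • EuclideanSpace.single 4 (1 : ℝ))))
      (axisPt ⁻¹' ball c R₁) := by
    refine eqOn_of_eqOn_off_horizProj hUo hLc.continuousOn ?_ fun z hz hPz => ?_
    · exact (hRc.congr fun y' => (hR_eq y').symm).continuousOn
    · have hne : ‖horizProj z‖ ^ 2 ≠ 0 := pow_ne_zero 2 (norm_ne_zero_iff.2 hPz)
      exact sub_eq_zero.1 ((mul_eq_zero.1 (hweighted z hz)).resolve_left hne)
  exact key hy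

/-- **The lifted swirl-free vorticity equation, local integrated form**, for the scalar family
written out, `f τ = hadamardQuotFst ((curl W τ) ·)₁ = ω_θ/ϱ` (`noSwirlLift_integral_eq'`).
[cite: KochNadirashviliSereginSverak2009, §5 (5.10) and p. 9; Seregin2020, proof of Thm. 2.1, last paragraph (arXiv p. 8)] -/
theorem noSwirlLift_integral_eq (hIc : I.OrdConnected)
    (hsmooth : ∀ τ ∈ I, ContDiff ℝ ∞ (W τ))
    (hunif : ∀ k : ℕ, ∀ τ ∈ I, ∀ ε > 0, ∃ δ > 0, ∀ τ' ∈ I, |τ' - τ| < δ → ∀ y,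
      ‖iteratedFDeriv ℝ k (W τ') y - iteratedFDeriv ℝ k (W τ) y‖ ≤ ε)
    (hax : ∀ τ ∈ I, IsAxisymmetric (W τ)) (hsw : ∀ τ ∈ I, HasNoSwirl (W τ))
    (hvort : ∀ x ∈ ball c R₁, ∀ s ∈ I, ∀ t ∈ I, s ≤ t →
      curl (W t) x - curl (W s) x =
        ∫ τ in s..t, ((Δ (curl (W τ))) x - fderiv ℝ (curl (W τ)) x (W τ x) +
          fderiv ℝ (W τ) x (curl (W τ) x)))
    (hvortc : ∀ x ∈ ball c R₁, ContinuousOn (fun τ => (Δ (curl (W τ))) x -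
      fderiv ℝ (curl (W τ)) x (W τ x) + fderiv ℝ (W τ) x (curl (W τ) x)) I)
    {y : EuclideanSpace ℝ (Fin 5)} (hy : axisPt y ∈ ball c R₁) {s t : ℝ} (hs : s ∈ I) (ht : t ∈ I)
    (hst : s ≤ t) :
    liftAx (hadamardQuotFst fun z => curl (W t) z 1) y -
        liftAx (hadamardQuotFst fun z => curl (W s) z 1) y =
      ∫ τ in s..t, ((Δ (liftAx (hadamardQuotFst fun z => curl (W τ) z 1))) y -
        fderiv ℝ (liftAx (hadamardQuotFst fun z => curl (W τ) z 1)) y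
          ((W τ (axisPt y)) 0 • (‖horizProj y‖⁻¹ • horizProj y) +
            (W τ (axisPt y)) 2 • EuclideanSpace.single 4 (1 : ℝ))) :=
  noSwirlLift_integral_eq' hIc hsmooth hunif hax hsw hvort hvortc
    (f := fun τ => hadamardQuotFst fun z => curl (W τ) z 1) (fun _ => rfl) hy hs ht hst

/-- **The lifted swirl-free vorticity equation, local classical form `∂ₜF = Δ₅F - DF[ã]`**
(KNSS 2009, p. 9: "Lemma 2.1 can be applied" to the lift; Seregin 2020, arXiv p. 8). Under the
hypotheses of `noSwirlLift_integral_eq'` with `I` an OPEN interval, for `y ∈ ℝ⁵` with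
`axisPt y ∈ B(c, R₁)` the time line `τ ↦ F(τ, y)` of the lift is differentiable at every `t ∈ I`,
with derivative `Δ₅F(t, y) - DF(t, y)[u_ϱ P y/|P y| + u₃ e₄]`, `u = W t (axisPt y)` (fundamental
theorem of calculus on the integrated form, the integrand being continuous in `τ`).
[cite: KochNadirashviliSereginSverak2009, §5 (5.10) and p. 9; Seregin2020, proof of Thm. 2.1, last paragraph (arXiv p. 8)] -/
theorem noSwirlLift_hasDerivAt (hI : IsOpen I) (hIc : I.OrdConnected)
    (hsmooth : ∀ τ ∈ I, ContDiff ℝ ∞ (W τ))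
    (hunif : ∀ k : ℕ, ∀ τ ∈ I, ∀ ε > 0, ∃ δ > 0, ∀ τ' ∈ I, |τ' - τ| < δ → ∀ y,
      ‖iteratedFDeriv ℝ k (W τ') y - iteratedFDeriv ℝ k (W τ) y‖ ≤ ε)
    (hax : ∀ τ ∈ I, IsAxisymmetric (W τ)) (hsw : ∀ τ ∈ I, HasNoSwirl (W τ))
    (hvort : ∀ x ∈ ball c R₁, ∀ s ∈ I, ∀ t ∈ I, s ≤ t →
      curl (W t) x - curl (W s) x =
        ∫ τ in s..t, ((Δ (curl (W τ))) x - fderiv ℝ (curl (W τ)) x (W τ x) +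
          fderiv ℝ (W τ) x (curl (W τ) x)))
    (hvortc : ∀ x ∈ ball c R₁, ContinuousOn (fun τ => (Δ (curl (W τ))) x -
      fderiv ℝ (curl (W τ)) x (W τ x) + fderiv ℝ (W τ) x (curl (W τ) x)) I)
    {f : ℝ → EuclideanSpace ℝ (Fin 3) → ℝ} (hfW : ∀ τ, f τ = hadamardQuotFst fun z => curl (W τ) z 1)
    {y : EuclideanSpace ℝ (Fin 5)} (hy : axisPt y ∈ ball c R₁) {t : ℝ} (ht : t ∈ I) :
    HasDerivAt (fun τ => liftAx (f τ) y)
      ((Δ (liftAx (f t))) y - fderiv ℝ (liftAx (f t)) y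
        ((W t (axisPt y)) 0 • (‖horizProj y‖⁻¹ • horizProj y) +
          (W t (axisPt y)) 2 • EuclideanSpace.single 4 (1 : ℝ))) t := by
  -- an earlier base time `s₀ ∈ I`
  obtain ⟨ε, hε, hball⟩ := Metric.isOpen_iff.1 hI t ht
  set s₀ : ℝ := t - ε / 2 with hs₀
  have hs₀I : s₀ ∈ I := hball (by
    rw [Metric.mem_ball, Real.dist_eq, hs₀, show t - ε / 2 - t = -(ε / 2) by ring, abs_neg,
      abs_of_pos (half_pos hε)]
    exact half_lt_self hε)
  have hs₀t : s₀ < t := by rw [hs₀]; linarith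
  -- the integrand at `y`, continuous on `I`
  obtain ⟨Ψ, hΨ⟩ : ∃ Ψ : ℝ → ℝ, ∀ τ, Ψ τ = (Δ (liftAx (f τ))) y - fderiv ℝ (liftAx (f τ)) y
      ((W τ (axisPt y)) 0 • (‖horizProj y‖⁻¹ • horizProj y) +
        (W τ (axisPt y)) 2 • EuclideanSpace.single 4 (1 : ℝ)) := ⟨_, fun _ => rfl⟩
  have hΨc : ContinuousOn Ψ I := by
    have h := noSwirlLift_integrand_continuousOn_time hsmooth hunif hax hsw hfW y
    exact h.congr fun τ _ => hΨ τ
  -- the representation `F τ = F s₀ + ∫_{s₀}^τ Ψ` for `τ ∈ I`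
  have hrep : ∀ τ ∈ I, liftAx (f τ) y = liftAx (f s₀) y + ∫ σ in s₀..τ, Ψ σ := by
    intro τ hτ
    rcases le_total s₀ τ with hle | hle
    · have h := noSwirlLift_integral_eq' hIc hsmooth hunif hax hsw hvort hvortc hfW hy hs₀I hτ hle
      rw [show (∫ σ in s₀..τ, Ψ σ) = ∫ σ in s₀..τ, ((Δ (liftAx (f σ))) y - fderiv ℝ (liftAx (f σ)) y
          ((W σ (axisPt y)) 0 • (‖horizProj y‖⁻¹ • horizProj y) +
            (W σ (axisPt y)) 2 • EuclideanSpace.single 4 (1 : ℝ))) from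
        intervalIntegral.integral_congr fun σ _ => hΨ σ]
      linarith
    · have h := noSwirlLift_integral_eq' hIc hsmooth hunif hax hsw hvort hvortc hfW hy hτ hs₀I hle
      rw [intervalIntegral.integral_symm,
        show (∫ σ in τ..s₀, Ψ σ) = ∫ σ in τ..s₀, ((Δ (liftAx (f σ))) y - fderiv ℝ (liftAx (f σ)) y
          ((W σ (axisPt y)) 0 • (‖horizProj y‖⁻¹ • horizProj y) +
            (W σ (axisPt y)) 2 • EuclideanSpace.single 4 (1 : ℝ))) from
        intervalIntegral.integral_congr fun σ _ => hΨ σ]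
      linarith
  -- differentiate the primitive
  have hIn : I ∈ 𝓝 t := hI.mem_nhds ht
  have hcont : ContinuousAt Ψ t := hΨc.continuousAt hIn
  have hmeas : StronglyMeasurableAtFilter Ψ (𝓝 t) volume :=
    hΨc.stronglyMeasurableAtFilter hI _ ht
  have hii : IntervalIntegrable Ψ volume s₀ t := by
    refine (hΨc.mono ?_).intervalIntegrable
    rw [uIcc_of_le hs₀t.le]; exact hIc.out hs₀I ht
  have hprim : HasDerivAt (fun τ => liftAx (f s₀) y + ∫ σ in s₀..τ, Ψ σ) (Ψ t) t :=
    (intervalIntegral.integral_hasDerivAt_right hii hmeas hcont).const_add _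
  have hev : (fun τ => liftAx (f τ) y) =ᶠ[𝓝 t] fun τ => liftAx (f s₀) y + ∫ σ in s₀..τ, Ψ σ := by
    filter_upwards [hIn] with τ hτ using hrep τ hτ
  rw [← hΨ t]
  exact hprim.congr_of_eventuallyEq hev

end Equation

/-! ### The maximum principle for `η = ω_θ/ϱ`: a bound by the parabolic boundary values -/

section MaxPrinciple

variable {W : ℝ → EuclideanSpace ℝ (Fin 3) → EuclideanSpace ℝ (Fin 3)} {I : Set ℝ}
  {c : EuclideanSpace ℝ (Fin 3)} {R₁ : ℝ}

/-- **The lifted ball.** For a centre `c` on the axis, `x = axisPt y` lies in `B(c, r)` iff `y`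
lies in the ball of `ℝ⁵` of the same radius about `c̃ = c₂ e₄`: `|axisPt y - c| = |y - c̃|`.
[folklore] -/
theorem dist_axisPt_eq_of_axis (hc : c 0 = 0 ∧ c 1 = 0) (y : EuclideanSpace ℝ (Fin 5)) :
    dist (axisPt y) c = dist y ((c 2) • EuclideanSpace.single 4 (1 : ℝ)) := by
  rw [EuclideanSpace.dist_eq, EuclideanSpace.dist_eq]
  congr 1
  have h4 : ∀ i : Fin 5, ((c 2) • EuclideanSpace.single 4 (1 : ℝ) : EuclideanSpace ℝ (Fin 5)) i =
      if i = 4 then c 2 else 0 := fun i => by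
    rw [PiLp.smul_apply, PiLp.single_apply, smul_eq_mul]
    split_ifs <;> simp
  simp only [Real.dist_eq, sq_abs, Fin.sum_univ_three, Fin.sum_univ_five, axisPt_apply_zero,
    axisPt_apply_one, axisPt_apply_two, hc.1, hc.2, h4]
  simp only [Fin.reduceEq, if_false, if_true, sub_zero]
  have h := norm_horizProj_sq y
  nlinarith [h]

/-- `|J x| = ϱ(x)`: the norm of the rotation generator is the cylindrical radius. [folklore] -/
private theorem norm_rotGen_eq_cylRadius_loc (x : EuclideanSpace ℝ (Fin 3)) : ‖rotGen x‖ = cylRadius x := by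
  rw [norm_eq_sqrt_real_inner, inner_rotGen_self_eq]
  rfl

/-- The meridian point `(ϱ(x), 0, x₂)` of `x` is at the same distance from an axis point `c` as
`x` itself. [folklore] -/
theorem dist_meridianPoint_meridian_eq_of_axis (hc : c 0 = 0 ∧ c 1 = 0) (x : EuclideanSpace ℝ (Fin 3)) :
    dist (meridianPoint (meridian x)) c = dist x c := by
  rw [EuclideanSpace.dist_eq, EuclideanSpace.dist_eq]
  congr 1
  simp only [Real.dist_eq, sq_abs, Fin.sum_univ_three, meridian_apply, meridianPoint_apply_zero,
    meridianPoint_apply_one, meridianPoint_apply_two, hc.1, hc.2, sub_zero]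
  have h : cylRadius x ^ 2 = x 0 ^ 2 + x 1 ^ 2 := by
    rw [cylRadius, Real.sq_sqrt (by positivity)]
  nlinarith [h]

/-- The cylindrical radius is at most the distance to any point of the axis. [folklore] -/
theorem cylRadius_le_dist_of_axis (hc : c 0 = 0 ∧ c 1 = 0) (x : EuclideanSpace ℝ (Fin 3)) :
    cylRadius x ≤ dist x c := by
  rw [EuclideanSpace.dist_eq, cylRadius]
  apply Real.sqrt_le_sqrt
  simp only [Real.dist_eq, sq_abs, Fin.sum_univ_three, hc.1, hc.2, sub_zero]
  nlinarith [sq_nonneg (x 2 - c 2)]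

/-- **`|f| = |ω|/ϱ` off the axis** for the scalar `f = ω_θ/ϱ` of a swirl-free axisymmetric smooth
field (`curl W = f · J`, `|J x| = ϱ(x)`): the value of `f` at a point off the axis is a local
quantity. [folklore] -/
theorem abs_scalar_eq_norm_curl_div {V : EuclideanSpace ℝ (Fin 3) → EuclideanSpace ℝ (Fin 3)}
    (hV : ContDiff ℝ ∞ V) (hax : IsAxisymmetric V) (hsw : HasNoSwirl V)
    {x : EuclideanSpace ℝ (Fin 3)} (hx : cylRadius x ≠ 0) :
    |hadamardQuotFst (fun y => curl V y 1) x| = ‖curl V x‖ / cylRadius x := by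
  obtain ⟨-, -, -, -, hcurl⟩ := noSwirl_family_structure (I := {(0 : ℝ)}) (W := fun _ => V)
    (fun _ _ => hV) (fun _ _ => hax) (fun _ _ => hsw) 0 rfl
  have h := hcurl x
  simp only at h
  rw [h, norm_smul, Real.norm_eq_abs, norm_rotGen_eq_cylRadius_loc, mul_div_assoc, div_self hx, mul_one]

/-- **A local sup bound for `f = ω_θ/ϱ` through the meridian segment.** For an axisymmetric
swirl-free smooth `V` and any `x`: `|f x| ≤ B` as soon as `‖D ω₁‖ ≤ B` on the horizontal segment
from the axis point `(0, 0, x₂)` to the meridian point `(ϱ(x), 0, x₂)` (`f x = f(ϱ(x), 0, x₂) =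
∫₀¹ ∂₀ω₁(σϱ(x), 0, x₂) dσ`); all these points are within `|x - c|` of any axis point `c`, and
within `ϱ(x)` of the meridian point. [folklore] -/
theorem abs_scalar_le_of_segment {V : EuclideanSpace ℝ (Fin 3) → EuclideanSpace ℝ (Fin 3)}
    (hV : ContDiff ℝ ∞ V) (hax : IsAxisymmetric V) (hsw : HasNoSwirl V)
    (x : EuclideanSpace ℝ (Fin 3)) {B : ℝ}
    (hB : ∀ σ ∈ Icc (0 : ℝ) 1,
      ‖fderiv ℝ (fun y => curl V y 1) (scaleFst σ (meridianPoint (meridian x)))‖ ≤ B) :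
    |hadamardQuotFst (fun y => curl V y 1) x| ≤ B := by
  have hfax : IsAxisymmetricScalar (hadamardQuotFst fun y => curl V y 1) :=
    isAxisymmetricScalar_hadamardQuotFst_curl hax hsw (hV.of_le (by norm_cast))
  rw [hfax.eq_comp_meridian x]
  have hB0 : 0 ≤ B := (norm_nonneg _).trans (hB 0 ⟨le_rfl, zero_le_one⟩)
  unfold hadamardQuotFst
  have h := intervalIntegral.norm_integral_le_of_norm_le_const (a := (0 : ℝ)) (b := 1) (C := B)
    (f := fun s => fderiv ℝ (fun y => curl V y 1) (scaleFst s (meridianPoint (meridian x)))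
      (EuclideanSpace.single 0 1))
    fun s hs => ?_
  · rw [← Real.norm_eq_abs]; simpa using h
  · have hs' : s ∈ Icc (0 : ℝ) 1 := by
      rw [uIoc_of_le zero_le_one] at hs; exact ⟨hs.1.le, hs.2⟩
    calc ‖fderiv ℝ (fun y => curl V y 1) (scaleFst s (meridianPoint (meridian x))) (EuclideanSpace.single 0 1)‖
        ≤ ‖fderiv ℝ (fun y => curl V y 1) (scaleFst s (meridianPoint (meridian x)))‖ *
            ‖(EuclideanSpace.single (0 : Fin 3) (1 : ℝ))‖ :=
          ContinuousLinearMap.le_opNorm _ _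
      _ ≤ B * 1 := by
          refine mul_le_mul (hB s hs') ?_ (norm_nonneg _) hB0
          rw [PiLp.norm_single, norm_one]
      _ = B := mul_one B

/-- **Maximum principle for `η = ω_θ/ϱ` (the parabolic boundary controls the interior).** Under
the hypotheses of `noSwirlLift_hasDerivAt` (module docstring), with the centre `c` of the ball
on the axis and `R' ≤ R₁`: if `|f| ≤ M` on the bottom `{t₀} × B̄(c, R')` and on the lateral
boundary `[t₀, t₁] × ∂B(c, R')` (`t₀, t₁ ∈ I`), then `|f| ≤ M` on `[t₀, t₁] × B̄(c, R')`.
Proof: the lift `F = liftAx f` solves `∂ₜF = Δ₅F - DF[ã]` classically on the lifted ball of `ℝ⁵`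
(`noSwirlLift_hasDerivAt`), so `±F - M` are sub-solutions in the sense of the weak parabolic
maximum principle (`weak_max_principle`: at a critical point the drift term vanishes), nonpositive
on the parabolic boundary of `[t₀, t₁] × B̄(c̃, R')`; and every value `f(t, x)` is a value of
`F(t, ·)` on the lifted ball (axisymmetry). This is the classical argument for swirl-free
axisymmetric flows (Ladyzhenskaya 1968; Ukhovskii–Yudovich 1968), in the local form used for
Seregin 2020, Thm. 2.1. [cite: Seregin2020, proof of Thm. 2.1, last paragraph (arXiv p. 8); KochNadirashviliSereginSverak2009 §5 p. 9] -/
theorem noSwirl_abs_scalar_le_of_boundary (hI : IsOpen I) (hIc : I.OrdConnected)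
    (hsmooth : ∀ τ ∈ I, ContDiff ℝ ∞ (W τ))
    (hunif : ∀ k : ℕ, ∀ τ ∈ I, ∀ ε > 0, ∃ δ > 0, ∀ τ' ∈ I, |τ' - τ| < δ → ∀ y,
      ‖iteratedFDeriv ℝ k (W τ') y - iteratedFDeriv ℝ k (W τ) y‖ ≤ ε)
    (hax : ∀ τ ∈ I, IsAxisymmetric (W τ)) (hsw : ∀ τ ∈ I, HasNoSwirl (W τ))
    (hvort : ∀ x ∈ ball c R₁, ∀ s ∈ I, ∀ t ∈ I, s ≤ t →
      curl (W t) x - curl (W s) x =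
        ∫ τ in s..t, ((Δ (curl (W τ))) x - fderiv ℝ (curl (W τ)) x (W τ x) +
          fderiv ℝ (W τ) x (curl (W τ) x)))
    (hvortc : ∀ x ∈ ball c R₁, ContinuousOn (fun τ => (Δ (curl (W τ))) x -
      fderiv ℝ (curl (W τ)) x (W τ x) + fderiv ℝ (W τ) x (curl (W τ) x)) I)
    {f : ℝ → EuclideanSpace ℝ (Fin 3) → ℝ} (hfW : ∀ τ, f τ = hadamardQuotFst fun z => curl (W τ) z 1)
    (hc : c 0 = 0 ∧ c 1 = 0) {R' : ℝ} (hR'R : R' ≤ R₁)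
    {t₀ t₁ : ℝ} (ht₀ : t₀ ∈ I) (ht₁ : t₁ ∈ I) {M : ℝ}
    (hbot : ∀ x ∈ closedBall c R', |f t₀ x| ≤ M)
    (hlat : ∀ t ∈ Icc t₀ t₁, ∀ x ∈ sphere c R', |f t x| ≤ M) :
    ∀ t ∈ Icc t₀ t₁, ∀ x ∈ closedBall c R', |f t x| ≤ M := by
  -- ## the lifted geometry
  set cL : EuclideanSpace ℝ (Fin 5) := (c 2) • EuclideanSpace.single 4 (1 : ℝ) with hcL
  set K : Set (EuclideanSpace ℝ (Fin 5)) := closedBall cL R' with hK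
  set U : Set (EuclideanSpace ℝ (Fin 5)) := ball cL R' with hU
  have hKc : IsCompact K := isCompact_closedBall _ _
  have hUo : IsOpen U := isOpen_ball
  have hUK : U ⊆ K := ball_subset_closedBall
  have hdist : ∀ y : EuclideanSpace ℝ (Fin 5), dist (axisPt y) c = dist y cL :=
    dist_axisPt_eq_of_axis hc
  have hUball : ∀ y ∈ U, axisPt y ∈ ball c R₁ := fun y hy => by
    rw [mem_ball, hdist]; exact lt_of_lt_of_le (mem_ball.1 hy) hR'R
  have hKclosed : ∀ y ∈ K, axisPt y ∈ closedBall c R' := fun y hy => by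
    rw [mem_closedBall, hdist]; exact mem_closedBall.1 hy
  have hKUsphere : ∀ y ∈ K \ U, axisPt y ∈ sphere c R' := fun y hy => by
    have h1 : dist y cL ≤ R' := mem_closedBall.1 hy.1
    have h2 : ¬ dist y cL < R' := fun h => hy.2 (mem_ball.2 h)
    rw [mem_sphere, hdist]; exact le_antisymm h1 (not_lt.1 h2)
  have hIsub : Icc t₀ t₁ ⊆ I := hIc.out ht₀ ht₁
  -- ## regularity of the lift
  obtain ⟨hC2, hFc⟩ := noSwirlLift_slices hsmooth hunif hax hsw hfW
  -- the time derivative on the lifted ball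
  obtain ⟨Ψ, hΨ⟩ : ∃ Ψ : ℝ → EuclideanSpace ℝ (Fin 5) → ℝ, ∀ τ y, Ψ τ y =
      (Δ (liftAx (f τ))) y - fderiv ℝ (liftAx (f τ)) y
        ((W τ (axisPt y)) 0 • (‖horizProj y‖⁻¹ • horizProj y) +
          (W τ (axisPt y)) 2 • EuclideanSpace.single 4 (1 : ℝ)) := ⟨_, fun _ _ => rfl⟩
  have hderiv : ∀ t ∈ I, ∀ y ∈ U, HasDerivAt (fun τ => liftAx (f τ) y) (Ψ t y) t := by
    intro t ht y hy
    rw [hΨ]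
    exact noSwirlLift_hasDerivAt hI hIc hsmooth hunif hax hsw hvort hvortc hfW (hUball y hy) ht
  -- ## the two comparison functions `σ F - M`, `σ = ±1`
  have key : ∀ σ : ℝ, (σ = 1 ∨ σ = -1) →
      ∀ t ∈ Icc t₀ t₁, ∀ y ∈ K, σ * liftAx (f t) y - M ≤ 0 := by
    intro σ hσ
    have hσabs : ∀ a : ℝ, σ * a ≤ |a| := fun a => by
      rcases hσ with h | h
      · rw [h, one_mul]; exact le_abs_self a
      · rw [h, neg_one_mul]; exact neg_le_abs a
    refine weak_max_principle (E := EuclideanSpace ℝ (Fin 5)) hKc hUo hUK (T₁ := t₀) (T₂ := t₁)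
      (w := fun t y => σ * liftAx (f t) y - M) (wₜ := fun t y => σ * Ψ t y) ?_ ?_ ?_ ?_ ?_ ?_
    · -- joint continuity
      have h1 : ContinuousOn (fun p : ℝ × EuclideanSpace ℝ (Fin 5) => liftAx (f p.1) p.2)
          (Icc t₀ t₁ ×ˢ K) := hFc.mono (prod_mono hIsub (subset_univ _))
      exact ((continuousOn_const.mul h1).sub continuousOn_const).congr fun p _ => rfl
    · -- `C²` slices
      intro t ht
      exact (contDiff_const.mul (hC2 t (hIsub ⟨ht.1.le, ht.2⟩))).sub contDiff_const
    · -- left time derivative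
      intro t ht y hy
      have h := ((hderiv t (hIsub ⟨ht.1.le, ht.2⟩) y hy).const_mul σ).sub_const M
      exact h.hasDerivWithinAt
    · -- the sub-solution implication: at a critical point the drift term vanishes
      intro t ht y hy hgrad hlap
      have htI : t ∈ I := hIsub ⟨ht.1.le, ht.2⟩
      have hF2 : ContDiff ℝ 2 (liftAx (f t)) := hC2 t htI
      have hFd : DifferentiableAt ℝ (liftAx (f t)) y := (hF2.differentiable (by norm_num)) y
      -- gradient
      have hgrad' : σ • fderiv ℝ (liftAx (f t)) y = 0 := by
        have h1 : fderiv ℝ (fun z => σ * liftAx (f t) z - M) y = σ • fderiv ℝ (liftAx (f t)) y := by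
          rw [fderiv_sub_const, fderiv_const_mul hFd]
        rw [← h1]; exact hgrad
      have hσ0 : σ ≠ 0 := by rcases hσ with h | h <;> simp [h]
      have hD0 : fderiv ℝ (liftAx (f t)) y = 0 := (smul_eq_zero.1 hgrad').resolve_left hσ0
      -- Laplacian
      have hΔ : (Δ (fun z => σ * liftAx (f t) z - M)) y = σ * (Δ (liftAx (f t))) y := by
        have h1 : ContDiffAt ℝ 2 (fun z => σ * liftAx (f t) z) y :=
          (contDiff_const.mul hF2).contDiffAt
        have h2 : ContDiffAt ℝ 2 (fun _ : EuclideanSpace ℝ (Fin 5) => (M : ℝ)) y := contDiffAt_const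
        have hfun : (fun z => σ * liftAx (f t) z - M) =
            (fun z => σ * liftAx (f t) z) - fun _ : EuclideanSpace ℝ (Fin 5) => (M : ℝ) := by
          funext z; simp only [Pi.sub_apply]
        have h3 : (Δ (fun z => σ * liftAx (f t) z)) y = σ * (Δ (liftAx (f t))) y := by
          have : (fun z => σ * liftAx (f t) z) = σ • liftAx (f t) := by
            funext z; simp [smul_eq_mul]
          rw [this, laplacian_smul σ hF2.contDiffAt, smul_eq_mul]
        rw [hfun, h1.laplacian_sub h2, h3, laplacian_const]
        simp
      rw [hΔ] at hlap
      -- conclude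
      show σ * Ψ t y ≤ 0
      rw [hΨ, hD0]
      simpa using hlap
    · -- bottom
      intro y hy
      have h := (hσabs (liftAx (f t₀) y)).trans (hbot _ (hKclosed y hy))
      show σ * liftAx (f t₀) y - M ≤ 0
      linarith
    · -- lateral boundary
      intro t ht y hy
      have h := (hσabs (liftAx (f t) y)).trans (hlat t ht _ (hKUsphere y hy))
      show σ * liftAx (f t) y - M ≤ 0
      linarith
  -- ## every value of `f t` on the closed ball is a value of the lift on `K`
  intro t ht x hx
  have htI : t ∈ I := hIsub ht
  have hfax : IsAxisymmetricScalar (f t) := (noSwirl_scalar_slices hsmooth hax hsw hfW t htI).2.1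
  set yx : EuclideanSpace ℝ (Fin 5) := (cylRadius x) • EuclideanSpace.single 0 (1 : ℝ) +
    (x 2) • EuclideanSpace.single 4 (1 : ℝ) with hyx
  have hax_pt : axisPt yx = meridianPoint (meridian x) := axisPt_lift_point x
  have hval : f t x = liftAx (f t) yx := by
    rw [liftAx_apply, hax_pt]; exact hfax.eq_comp_meridian x
  have hyK : yx ∈ K := by
    rw [hK, mem_closedBall, ← hdist, hax_pt, dist_meridianPoint_meridian_eq_of_axis hc]
    exact mem_closedBall.1 hx
  have h1 := key 1 (Or.inl rfl) t ht yx hyK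
  have h2 := key (-1) (Or.inr rfl) t ht yx hyK
  rw [hval, abs_le]
  constructor <;> linarith

/-- **The vorticity bound.** Under the conclusion of `noSwirl_abs_scalar_le_of_boundary`
(`|f x| ≤ M` on `B̄(c, R')`), the vorticity is bounded there: `‖curl V x‖ ≤ M ϱ(x) ≤ M R'`
(`curl V = f · J`, `|J x| = ϱ(x) ≤ |x - c|` for `c` on the axis). [folklore] -/
theorem norm_curl_le_of_abs_scalar_le {V : EuclideanSpace ℝ (Fin 3) → EuclideanSpace ℝ (Fin 3)}
    (hV : ContDiff ℝ ∞ V) (hax : IsAxisymmetric V) (hsw : HasNoSwirl V)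
    (hc : c 0 = 0 ∧ c 1 = 0) {R' M : ℝ} (hM : 0 ≤ M)
    (hf : ∀ x ∈ closedBall c R', |hadamardQuotFst (fun y => curl V y 1) x| ≤ M)
    {x : EuclideanSpace ℝ (Fin 3)} (hx : x ∈ closedBall c R') : ‖curl V x‖ ≤ M * R' := by
  obtain ⟨-, -, -, -, hcurl⟩ := noSwirl_family_structure (I := {(0 : ℝ)}) (W := fun _ => V)
    (fun _ _ => hV) (fun _ _ => hax) (fun _ _ => hsw) 0 rfl
  have h := hcurl x
  simp only at h
  have hrad : cylRadius x ≤ R' := (cylRadius_le_dist_of_axis hc x).trans (mem_closedBall.1 hx)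
  rw [h, norm_smul, Real.norm_eq_abs, norm_rotGen_eq_cylRadius_loc]
  exact mul_le_mul (hf x hx) hrad (cylRadius_nonneg x) hM

end MaxPrinciple

end Literature.Analysis.FluidPDE

end
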